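import Mathlib
import Summits.NavierStokesRegularity.NavierStokesRegularity.Theorems.TaoLadderRungTwoFlatCoMovingEnergyDecay
import Summits.NavierStokesRegularity.NavierStokesRegularity.Theorems.TaoLadderRungTwoFlatGaugeGronwallOn
import HarnessLib

/-!
# The co-moving deviation-energy inequality along two EXACT GRADED WINDOW FLOWS (junk race L8b-1 on certificate
  windows) (helper for the transfer theorem stmt-NavierStokesRegularity-23909 `GradedAdiabaticWake`; route
  TaoLadderRungTwoFlat; cell harvest/h2-tao-ladder, p1 g21; LADDER §49.3/49.6, HopTube `TubeStepNear`)

`…CoMovingEnergyDecay.coMovingEnergyOn_decay_Icc` is stated for a deviation `u` with `u̇ = Q(W+u) − Q(W)` on an open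
time interval and continuity on its closure. Child 2's objects are EXACT (`κ₁ = 0`) format flows
`PseudoFlowOnShift S♭ τ ε₀ (mirrorTable ε ε) 0 κ₂ …` on a certificate window `[0, τ]` — the reference flow `W` (from the
reference state) and the hop flow `S` (from the kicked tube state). This file discharges the calculus hypotheses from the
two flow structures (`QuadPolar.hasDerivAt_of_pseudoFlowOnShift_exact`, `continuousOn_of_pseudoFlowOnShift`):

* `hasDerivAt_deviation_of_pseudoFlows` — `u = S − W` solves the deviation equation on `Ioo 0 τ`;
* `coMovingEnergyOn_decay_of_pseudoFlows` — for `0 ≤ t₁ ≤ t₂ ≤ τ`: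
  `V_{[a,P]}(t₂) ≤ e^{−μ(t₂−t₁)}V_{[a,P]}(t₁) + Ē(1 − e^{−μ(t₂−t₁)})/μ` under the a-priori amplitude / template / clock
  bounds and the edge-input bound of `coMovingEnergyOn_decay_Icc` (graded clocks `c_n = (1+ε₀)^{5n/2}`, `c̄` a bound on
  the block's clocks, e.g. the clock at the edge by `clock_mono`).

HONEST FRAMING: calculus about MODEL-lattice certificate flows (Tao 2016 §4 vocabulary on `S♭`); all bounds are
HYPOTHESES; nothing certified; nothing about the Navier–Stokes equations.
-/

noncomputable section

-- the sub-problem namespace repeats the summit name by design (D-0017)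
set_option linter.dupNamespace false

namespace Summit.NavierStokesRegularity.NavierStokesRegularity.Theorems

open Set Filter Literature.Analysis.FluidPDE Literature.Analysis.FluidPDE.TaoCascade
open scoped Topology

namespace MirrorPulse

/-- Along two exact graded window flows `W`, `S` the deviation `u = S − W` solves `u̇ = Q(W+u) − Q(W)` at every interior
time. [cite: Tao2016AveragedNS, §4 Lemma 4.1 (4.8); route TaoLadderRungTwoFlat, L8b-1 on windows] -/
theorem hasDerivAt_deviation_of_pseudoFlows {ε ε₀ τ κ₂ κ₂' : ℝ} {W₀ FW₀ BW₀ S₀ FS₀ BS₀ : Fin 2 → ℤ → ℝ}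
    {W FW S FS : Fin 2 → ℤ → ℝ → ℝ}
    (hW : PseudoFlowOnShift shiftSetFlat τ ε₀ (mirrorTable ε ε) 0 κ₂ W₀ FW₀ BW₀ W FW)
    (hS : PseudoFlowOnShift shiftSetFlat τ ε₀ (mirrorTable ε ε) 0 κ₂' S₀ FS₀ BS₀ S FS)
    {t : ℝ} (ht : t ∈ Ioo 0 τ) (i : Fin 2) (n : ℤ) :
    HasDerivAt ((S - W) i n) (quadTermOn shiftSetFlat ε₀ (mirrorTable ε ε) (W + (S - W)) i n t
      - quadTermOn shiftSetFlat ε₀ (mirrorTable ε ε) W i n t) t := by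
  have e : W + (S - W) = S := by abel
  rw [e]
  have h := (QuadPolar.hasDerivAt_of_pseudoFlowOnShift_exact hS i n ht).sub
    (QuadPolar.hasDerivAt_of_pseudoFlowOnShift_exact hW i n ht)
  have hfun : (S i n - W i n) = (S - W) i n := by funext s; simp
  rw [hfun] at h
  exact h

/-- **CO-MOVING ENERGY DECAY ALONG TWO EXACT GRADED WINDOW FLOWS.** See the module docstring.
[cite: Tao2016AveragedNS, §4 (4.3), (4.8), §5–§6; route TaoLadderRungTwoFlat, L8b-1 on windows (LADDER §49.3/49.6)] -/
theorem coMovingEnergyOn_decay_of_pseudoFlows {ε ε₀ τ κ₂ κ₂' θ σ n₀ A M cbar μ Ebar t₁ t₂ : ℝ}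
    {W₀ FW₀ BW₀ S₀ FS₀ BS₀ : Fin 2 → ℤ → ℝ} {W FW S FS : Fin 2 → ℤ → ℝ → ℝ}
    (hW : PseudoFlowOnShift shiftSetFlat τ ε₀ (mirrorTable ε ε) 0 κ₂ W₀ FW₀ BW₀ W FW)
    (hS : PseudoFlowOnShift shiftSetFlat τ ε₀ (mirrorTable ε ε) 0 κ₂' S₀ FS₀ BS₀ S FS)
    (hε : 0 ≤ ε) (hε₀ : -1 ≤ ε₀) (hθ : 0 ≤ θ) {a P : ℤ} (haP : a ≤ P) (h0t₁ : 0 ≤ t₁) (ht : t₁ ≤ t₂)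
    (ht₂ : t₂ ≤ τ)
    (hA : ∀ t ∈ Ioo t₁ t₂, ∀ i, ∀ n ∈ Finset.Icc (a - 1) (P + 1), |(S - W) i n t| ≤ A)
    (hM : ∀ t ∈ Ioo t₁ t₂, ∀ i, ∀ n ∈ Finset.Icc (a - 1) (P + 1), |W i n t| ≤ M)
    (hc : ∀ n ∈ Finset.Icc (a - 1) P, clock ε₀ n ≤ cbar)
    (hE : ∀ t ∈ Ioo t₁ t₂,
      Real.exp (θ * ((a : ℝ) - (n₀ + σ * t))) * |fluxT ε ε₀ (S - W) (a - 1) t|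
        + Real.exp (θ * ((P : ℝ) - (n₀ + σ * t))) * |fluxT ε ε₀ (S - W) P t|
        + (1 + ε) * cbar * M * (Real.exp (θ * ((a : ℝ) - (n₀ + σ * t))) * (S - W) 1 (a - 1) t ^ 2
            + Real.exp (θ * ((P : ℝ) - (n₀ + σ * t))) * (S - W) 0 (P + 1) t ^ 2) ≤ Ebar)
    (hμ : 0 < μ) (hμle : μ ≤ σ * θ - 2 * (1 + ε) * cbar * (A * Real.sinh (θ / 2) + M * (3 + Real.exp θ))) :
    coMovingEnergyOn (Finset.Icc a P) θ (n₀ + σ * t₂) (S - W) t₂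
      ≤ Real.exp (-μ * (t₂ - t₁)) * coMovingEnergyOn (Finset.Icc a P) θ (n₀ + σ * t₁) (S - W) t₁
        + Ebar * (1 - Real.exp (-μ * (t₂ - t₁))) / μ := by
  have hsub : Icc t₁ t₂ ⊆ Icc 0 τ := Icc_subset_Icc h0t₁ ht₂
  have hcont : ∀ i, ∀ n ∈ Finset.Icc a P, ContinuousOn ((S - W) i n) (Icc t₁ t₂) := fun i n _ => by
    have hS' := (QuadPolar.continuousOn_of_pseudoFlowOnShift hS i n).mono hsub
    have hW' := (QuadPolar.continuousOn_of_pseudoFlowOnShift hW i n).mono hsub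
    have e : (S - W) i n = fun s => S i n s - W i n s := by funext s; simp
    rw [e]; exact hS'.sub hW'
  have hder : ∀ t ∈ Ioo t₁ t₂, ∀ i, ∀ n ∈ Finset.Icc a P,
      HasDerivAt ((S - W) i n) (quadTermOn shiftSetFlat ε₀ (mirrorTable ε ε) (W + (S - W)) i n t
        - quadTermOn shiftSetFlat ε₀ (mirrorTable ε ε) W i n t) t :=
    fun t ht' i n _ => hasDerivAt_deviation_of_pseudoFlows hW hS ⟨h0t₁.trans_lt ht'.1, ht'.2.trans_le ht₂⟩ i n
  exact coMovingEnergyOn_decay_Icc hε hε₀ hθ haP ht hcont hder hA hM hc hE hμ hμle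

end MirrorPulse

end Summit.NavierStokesRegularity.NavierStokesRegularity.Theorems

end
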